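import Mathlib
import Literature.Computability.Complexity.RandomKSatEnsembleOGP

/-!
# Route OverlapGapAlgebra, crux `SearchHardWindow` (stmt-PneNP-2460): the `Δ`-step transition
# kernel of the resampling chain

For the `ε`-resampling Markov kernel `P_ε(y, y') = ∏_i ((1 − ε)·[y i = y' i] + ε/|Γ|)` on a finite
product space `ι → Γ` (vocabulary `resampleKernel` of
`Literature/Computability/Complexity/RandomKSatEnsembleOGP.lean`; O'Donnell 2014 Def. 8.26,
Huang–Sellke 2025 §3.3) the `Δ`-step transition weights are again a resampling kernel:
the total weight of the length-`Δ` paths `y : Fin (Δ+1) → ι → Γ` from `w` to `y'`,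
`Σ_y [y 0 = w] [y Δ = y'] ∏_{t<Δ} P_ε(y t, y (t+1))`, equals `P_{1 − (1−ε)^Δ}(w, y')`
(`stub_kernelPowPaths`; in operator language `T_ρ ^ Δ = T_{ρ^Δ}`, `ρ = 1 − ε`). This closed form of
the `Δ`-step kernel is what the Markov-property bookkeeping of the chaos lemma (Huang–Sellke 2025,
Lemma 3.23) in line `Sketch` consumes.

Proof: induction on `Δ`, given the one-step composition identity
`Σ_{y''} P_ε(y, y'') P_{ε'}(y'', y') = P_{1 − (1−ε)(1−ε')}(y, y')` as a hypothesis. At `Δ = 0` both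
sides are the identity kernel `[w = y']` (`kpp_resampleKernel_zero`). For `Δ + 1`, split a path into
its first point and the remaining length-`Δ` path (`Fin.consEquiv`, `Fin.prod_univ_succ`), insert the
intermediate point `y'' = y 1` as a summation variable, apply the induction hypothesis to the paths
from `y''` to `y'`, and compose: `1 − (1 − ε)·(1 − (1 − (1−ε)^Δ)) = 1 − (1−ε)^{Δ+1}`.
-/

set_option linter.dupNamespace false -- `Summit.PneNP.PneNP.…`: summit = sub-problem

namespace Summit.PneNP.PneNP.Theorems

open Finset
open Literature.Computability.Complexity
open scoped Classical

/-- At `ε = 0` the resampling kernel is the identity kernel: `P_0(w, y') = [w = y']`. -/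
theorem kpp_resampleKernel_zero {ι Γ : Type*} [Fintype ι] [Fintype Γ] [DecidableEq Γ]
    (w y' : ι → Γ) : resampleKernel 0 w y' = if w = y' then 1 else 0 := by
  unfold resampleKernel
  simp only [sub_zero, one_mul, zero_div, add_zero]
  rw [Fintype.prod_boole]
  exact if_congr funext_iff.symm rfl rfl

/-- Inserting the second point of a path as a summation variable:
`[x Δ = y'] · P_ε(w, x 0) · W(x) = Σ_{y''} P_ε(w, y'') · ([x 0 = y''] [x Δ = y'] · W(x))`. -/
theorem kpp_insert_midpoint {ι Γ : Type*} [Fintype ι] [DecidableEq ι] [Fintype Γ] [DecidableEq Γ]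
    (ε : ℝ) (Δ : ℕ) (w y' : ι → Γ) (x : Fin (Δ + 1) → ι → Γ) (W : ℝ) :
    (if x (Fin.last Δ) = y' then resampleKernel ε w (x 0) * W else 0) =
      ∑ y'' : ι → Γ, resampleKernel ε w y'' *
        (if x 0 = y'' ∧ x (Fin.last Δ) = y' then W else 0) := by
  rw [Fintype.sum_eq_single (x 0) fun b hb => by rw [if_neg fun h => hb h.1.symm, mul_zero]]
  by_cases h : x (Fin.last Δ) = y'
  · rw [if_pos h, if_pos ⟨rfl, h⟩]
  · rw [if_neg h, if_neg fun h' => h h'.2, mul_zero]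

/-- **The `Δ`-step kernel of the resampling chain** (`T_ρ ^ Δ = T_{ρ^Δ}`): given the one-step
composition identity `Σ_{y''} P_ε(y, y'') P_{ε'}(y'', y') = P_{1 − (1−ε)(1−ε')}(y, y')`, the total
weight of the length-`Δ` paths of the `ε`-resampling chain from `w` to `y'` is
`P_{1 − (1−ε)^Δ}(w, y')`. -/
theorem stub_kernelPowPaths
    (hSemi : ∀ {ι Γ : Type} [Fintype ι] [DecidableEq ι] [Fintype Γ] [DecidableEq Γ] [Nonempty Γ]
      (ε ε' : ℝ) (y y' : ι → Γ), ∑ y'' : ι → Γ, resampleKernel ε y y'' * resampleKernel ε' y'' y' =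
        resampleKernel (1 - (1 - ε) * (1 - ε')) y y')
    {ι Γ : Type} [Fintype ι] [DecidableEq ι] [Fintype Γ] [DecidableEq Γ] [Nonempty Γ]
    (ε : ℝ) (Δ : ℕ) (w y' : ι → Γ) :
    ∑ y : Fin (Δ + 1) → ι → Γ,
        (if y 0 = w ∧ y (Fin.last Δ) = y' then
          ∏ t : Fin Δ, resampleKernel ε (y t.castSucc) (y t.succ) else 0)
      = resampleKernel (1 - (1 - ε) ^ Δ) w y' := by
  induction Δ generalizing w with
  | zero =>
    rw [← (Equiv.funUnique (Fin 1) (ι → Γ)).symm.sum_comp]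
    simp only [Finset.univ_eq_empty, Finset.prod_empty, Fin.last_zero,
      Equiv.funUnique_symm_apply, uniqueElim_const, pow_zero, sub_self]
    rw [Fintype.sum_eq_single w fun a ha => if_neg fun h => ha h.1, kpp_resampleKernel_zero]
    exact if_congr ⟨fun h => h.2, fun h => ⟨rfl, h⟩⟩ rfl rfl
  | succ Δ ih =>
    rw [← (Fin.consEquiv fun _ : Fin (Δ + 1 + 1) => ι → Γ).sum_comp, Fintype.sum_prod_type]
    simp only [Fin.consEquiv_apply, Fin.prod_univ_succ, Fin.castSucc_zero, Fin.cons_zero,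
      Fin.cons_succ, Fin.castSucc_succ, ← Fin.succ_last]
    rw [Fintype.sum_eq_single w fun a ha => Fintype.sum_eq_zero _ fun x => if_neg fun h => ha h.1]
    calc ∑ x : Fin (Δ + 1) → ι → Γ,
          (if w = w ∧ x (Fin.last Δ) = y' then
            resampleKernel ε w (x 0) *
              ∏ t : Fin Δ, resampleKernel ε (x t.castSucc) (x t.succ) else 0)
        = ∑ x : Fin (Δ + 1) → ι → Γ, ∑ y'' : ι → Γ, resampleKernel ε w y'' *
            (if x 0 = y'' ∧ x (Fin.last Δ) = y' then
              ∏ t : Fin Δ, resampleKernel ε (x t.castSucc) (x t.succ) else 0) := by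
          refine Finset.sum_congr rfl fun x _ => ?_
          rw [← kpp_insert_midpoint]
          exact if_congr ⟨fun h => h.2, fun h => ⟨rfl, h⟩⟩ rfl rfl
      _ = ∑ y'' : ι → Γ, resampleKernel ε w y'' * resampleKernel (1 - (1 - ε) ^ Δ) y'' y' := by
          rw [Finset.sum_comm]
          refine Finset.sum_congr rfl fun y'' _ => ?_
          rw [← Finset.mul_sum, ih y'']
      _ = resampleKernel (1 - (1 - ε) ^ (Δ + 1)) w y' := by
          rw [hSemi, sub_sub_cancel, pow_succ']

end Summit.PneNP.PneNP.Theorems
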